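import Summits.NavierStokesRegularity.FluidComputer.TubeTableFat18
import HarnessLib

/-!
# Kernel run of the fat restart tube, chunks 24 … 29 (bp3 gen 15)

HONEST FRAMING: low prior, high value-of-information experiment on Tao's machine paradigm; NOT a
claim that NS blows up.

Kernel evaluations (`decide +kernel`; no `native_decide`, no extra axioms) of the in-tree tube checker
`runTube` (`P = 60`, 12 Taylor terms, cube `Rt`, read-out `CLt`) on the chunks `cF 24 … cF 29` of
`TubeTableFat18.lean`, each from the recorded boundary state `sF i` to `sF (i+1)`.

[cite: Tao2016AveragedNS, §5.5 Thm 5.3 (5.5)]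
-/

namespace Summit.NavierStokesRegularity.FluidComputer

namespace TubeTableFat18

open Literature.Analysis.FluidPDE.FluidComputer Literature.Analysis.FluidPDE.FluidComputer.TubeTable
open Literature.Analysis.FluidPDE.FluidComputer.ThresholdLevelTable (GIt)

set_option maxHeartbeats 10000000 in
set_option maxRecDepth 200000 in
/-- Chunk 24 of the fat tube run (steps 1200 … 1249, `h = 2^-11`). [folklore] -/
theorem runF_24 : runTube 60 12 GIt CLt Rt (sF 24) (cF 24) = some (sF (24 + 1)) := by
  decide +kernel

set_option maxHeartbeats 10000000 in
set_option maxRecDepth 200000 in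
/-- Chunk 25 of the fat tube run (steps 1250 … 1269, `h = 2^-11`). [folklore] -/
theorem runF_25 : runTube 60 12 GIt CLt Rt (sF 25) (cF 25) = some (sF (25 + 1)) := by
  decide +kernel

set_option maxHeartbeats 10000000 in
set_option maxRecDepth 200000 in
/-- Chunk 26 of the fat tube run (steps 1270 … 1319, `h = 2^-13`). [folklore] -/
theorem runF_26 : runTube 60 12 GIt CLt Rt (sF 26) (cF 26) = some (sF (26 + 1)) := by
  decide +kernel

set_option maxHeartbeats 10000000 in
set_option maxRecDepth 200000 in
/-- Chunk 27 of the fat tube run (steps 1320 … 1369, `h = 2^-13`). [folklore] -/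
theorem runF_27 : runTube 60 12 GIt CLt Rt (sF 27) (cF 27) = some (sF (27 + 1)) := by
  decide +kernel

set_option maxHeartbeats 10000000 in
set_option maxRecDepth 200000 in
/-- Chunk 28 of the fat tube run (steps 1370 … 1419, `h = 2^-13`). [folklore] -/
theorem runF_28 : runTube 60 12 GIt CLt Rt (sF 28) (cF 28) = some (sF (28 + 1)) := by
  decide +kernel

set_option maxHeartbeats 10000000 in
set_option maxRecDepth 200000 in
/-- Chunk 29 of the fat tube run (steps 1420 … 1453, `h = 2^-13`). [folklore] -/
theorem runF_29 : runTube 60 12 GIt CLt Rt (sF 29) (cF 29) = some (sF (29 + 1)) := by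
  decide +kernel

end TubeTableFat18

end Summit.NavierStokesRegularity.FluidComputer
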